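import Literature.Computability.Cryptography.QuantumTuringMachineUnidirectional
import Literature.Computability.Cryptography.CliffordTPolyTimeEntries
import Literature.Computability.Cryptography.QubitRegisterCliffordTProofs
import Literature.Computability.QuantumComplexity.ReversibleCliffordT
import Literature.Computability.QuantumComplexity.WireConjugation
import HarnessLib

/-!
# The circuit simulating a quantum Turing machine, II: the gate set `Clifford+T ∪ {G₁(M)}`

Third file of the formalisation of the simulation of (unidirectional) quantum Turing machines by
quantum circuits (Yao 1993; Nishimura–Ozawa 2002, Thm. 4.3). Nishimura–Ozawa simulate `t` steps
of `M` by a circuit over the two gates `G₁` (a fixed unitary carrying the transition amplitudes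
of `M`) and `G₂` (a classical reversible gate), and only afterwards (Thm. 5.2) decompose these
into elementary gates. Accordingly the simulating circuits of this formalisation are over the
gate set

  `yaoGateSet M D` = Clifford+`T` (for the classical reversible parts, compiled exactly by
  `revCompile`) `∪ {localGate M D}`,

where `localGate M D`, the analogue of `G₁` for a unidirectional machine with direction
assignment `D` (Bernstein–Vazirani 1997, Def. 3.14), is the local matrix
`A_D[(q', τ), (p, σ)] = δ(p, σ, q', τ, D q')` (`QTM.localMat`) acting on the one-hot codes
`codeSR (p, σ)` of (state, scanned symbol) inside the register of `|Q| + |Σ|` qubits, extended by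
the identity on the basis vectors that are not codes:

* `codeSR`, `codeSR_injective`, `dec`, `IsCode` — the unary code of a pair and its decoding;
* `localGate`, `localGate_apply_codeSR` (its columns at codes:
  `G |code x⟩ = ∑_y A_D[y, x] |code y⟩`), `localGate_mem_unitaryGroup` (unitary when `A_D` is,
  i.e. for well-formed unidirectional machines, `QTM.localMat_mem_unitaryGroup`),
  `localGate_apply_mem` (entries in `amplitudes M ∪ {0, 1}`);
* `YOp`, `yaoGateSet M D` with `yaoGateSet_isUnitary` and `yaoGateSet_polyTimeEntries`
  (polynomial-time computable entries when the amplitudes of `M` are; Bernstein–Vazirani 1997,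
  Def. 3.2 / §6), the transport `QGate.ofCT` of Clifford+`T` gates with `toMatrix_ofCT`,
  `toMatrix_mapOfCT`, and `placeGate_mulVec_basisState_eq_sum` (a placed gate on a basis state as
  the superposition of the overwritten labels).

No named facts are introduced.

## References

* H. Nishimura, M. Ozawa, *Computational complexity of uniform quantum circuit families and
  quantum Turing machines*, Theoret. Comput. Sci. 276 (2002) 147–181 = arXiv:quant-ph/9906095
  [NishimuraOzawa2002]: Thm. 4.3 and its proof (the gates `G₁`, `G₂`), Thm. 5.2 (proof, first
  half: decomposition of `G₁` over `𝒢_PC`).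
* A. C.-C. Yao, *Quantum circuit complexity*, Proc. 34th FOCS (1993) 352–361 [YaoFOCS1993].
* E. Bernstein, U. Vazirani, *Quantum complexity theory*, SIAM J. Comput. 26 (1997) 1411–1473
  [BernsteinVaziraniSICOMP1997]: Def. 3.2 (amplitudes in `C̃`), Def. 3.14, Thm. 5.3.
* M. A. Nielsen, I. L. Chuang, *Quantum Computation and Quantum Information*, CUP 2010, §4.3
  (controlled and placed operations) [NielsenChuang2010].
-/

noncomputable section

namespace Literature.Computability.QuantumComplexity

namespace YaoSim

open Cryptography QTM Function Turing Matrix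
open scoped BigOperators

variable (M : QTM)

/-! ### Unary codes of (state, symbol) pairs -/

/-- The number of state qubits (`|Q|`, unary code). [folklore] -/
abbrev kq : ℕ := Fintype.card M.Λ

/-- The number of symbol qubits (`|Σ|`, unary code). [folklore] -/
abbrev ks : ℕ := Fintype.card M.Γ

/-- The **unary code** of a pair (state, symbol) on `|Q| + |Σ|` qubits: the one-hot code of the
state followed by the one-hot code of the symbol (Nishimura–Ozawa 2002, proof of Thm. 4.3, uses
binary codes `|q; σ⟩`; any injective coding does). [cite: NishimuraOzawa2002, Thm. 4.3 (proof)] -/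
def codeSR (x : M.Λ × M.Γ) : QReg (kq M + ks M) :=
  Fin.append (fun i : Fin (kq M) => decide (i = Fintype.equivFin M.Λ x.1))
    (fun i : Fin (ks M) => decide (i = Fintype.equivFin M.Γ x.2))

variable {M}

/-- The state part of a code. [folklore] -/
@[simp] theorem codeSR_castAdd (x : M.Λ × M.Γ) (i : Fin (kq M)) :
    codeSR M x (Fin.castAdd (ks M) i) = decide (i = Fintype.equivFin M.Λ x.1) := by
  simp [codeSR]

/-- The symbol part of a code. [folklore] -/
@[simp] theorem codeSR_natAdd (x : M.Λ × M.Γ) (i : Fin (ks M)) :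
    codeSR M x (Fin.natAdd (kq M) i) = decide (i = Fintype.equivFin M.Γ x.2) := by
  simp [codeSR]

/-- Codes are injective. [folklore] -/
theorem codeSR_injective : Injective (codeSR M) := by
  intro x y h
  have h₁ := congrFun h (Fin.castAdd (ks M) (Fintype.equivFin M.Λ x.1))
  have h₂ := congrFun h (Fin.natAdd (kq M) (Fintype.equivFin M.Γ x.2))
  simp only [codeSR_castAdd, codeSR_natAdd, decide_true, Bool.true_eq, decide_eq_true_eq,
    EmbeddingLike.apply_eq_iff_eq] at h₁ h₂
  exact Prod.ext h₁ h₂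

variable (M) in
/-- Decoding (a left inverse of `codeSR`, arbitrary off the codes). [folklore] -/
def dec : QReg (kq M + ks M) → M.Λ × M.Γ :=
  haveI : Nonempty (M.Λ × M.Γ) := ⟨(M.start, default)⟩
  Function.invFun (codeSR M)

/-- `dec` decodes codes. [folklore] -/
@[simp] theorem dec_codeSR (x : M.Λ × M.Γ) : dec M (codeSR M x) = x :=
  @Function.leftInverse_invFun _ _ ⟨(M.start, default)⟩ _ codeSR_injective x

variable (M) in
/-- A basis label of the register is a code iff re-encoding its decoding gives it back. [folklore] -/
def IsCode (u : QReg (kq M + ks M)) : Prop := codeSR M (dec M u) = u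

/-- Being a code is decidable. -/
instance (u : QReg (kq M + ks M)) : Decidable (IsCode M u) := by
  unfold IsCode; infer_instance

/-- Codes are codes. [folklore] -/
theorem isCode_codeSR (x : M.Λ × M.Γ) : IsCode M (codeSR M x) := by
  simp [IsCode]

/-- A label is a code iff it is in the range of `codeSR`. [folklore] -/
theorem isCode_iff {u : QReg (kq M + ks M)} : IsCode M u ↔ ∃ x, u = codeSR M x :=
  ⟨fun h => ⟨dec M u, h.symm⟩, fun ⟨x, hx⟩ => hx ▸ isCode_codeSR x⟩

/-! ### The local gate -/

variable (M) in
/-- **The local gate** `G₁` of a unidirectional machine: the local matrix `A_D` (`QTM.localMat`)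
on the codes, the identity on the non-codes (Nishimura–Ozawa 2002, proof of Thm. 4.3, condition
(i) on `G₁` — restricted to one head position — and condition (ii), identity elsewhere). [cite: NishimuraOzawa2002, Thm. 4.3 (proof)] -/
def localGate (D : M.Λ → Dir) : Matrix (QReg (kq M + ks M)) (QReg (kq M + ks M)) ℂ :=
  Matrix.of fun v u =>
    if IsCode M u then (if IsCode M v then M.localMat D (dec M v) (dec M u) else 0)
    else (if v = u then 1 else 0)

/-- **Columns of the local gate at codes**: `G₁ |code x⟩ = ∑_y A_D[y, x] |code y⟩`, entrywise. [cite: NishimuraOzawa2002, Thm. 4.3 (proof)] -/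
theorem localGate_apply_codeSR (D : M.Λ → Dir) (v : QReg (kq M + ks M)) (x : M.Λ × M.Γ) :
    localGate M D v (codeSR M x) =
      ∑ y : M.Λ × M.Γ, if v = codeSR M y then M.localMat D y x else 0 := by
  simp only [localGate, Matrix.of_apply, isCode_codeSR, if_true, dec_codeSR]
  by_cases hv : IsCode M v
  · obtain ⟨y, rfl⟩ := isCode_iff.1 hv
    rw [if_pos (isCode_codeSR y), dec_codeSR, Finset.sum_eq_single y]
    · rw [if_pos rfl]
    · intro y' _ hy'
      rw [if_neg fun h => hy' (codeSR_injective h).symm]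
    · exact fun h => absurd (Finset.mem_univ y) h
  · rw [if_neg hv, Finset.sum_eq_zero]
    intro y _
    rw [if_neg fun h => hv (isCode_iff.2 ⟨y, h⟩)]

/-- Columns of the local gate off the codes: the identity. [cite: NishimuraOzawa2002, Thm. 4.3 (proof)] -/
theorem localGate_apply_of_not_isCode (D : M.Λ → Dir) (v : QReg (kq M + ks M))
    {u : QReg (kq M + ks M)} (hu : ¬ IsCode M u) :
    localGate M D v u = if v = u then 1 else 0 := by
  simp [localGate, hu]

/-- Every entry of the local gate is a transition amplitude of `M`, or `0`, or `1`. [folklore] -/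
theorem localGate_apply_mem (D : M.Λ → Dir) (v u : QReg (kq M + ks M)) :
    localGate M D v u ∈ M.amplitudes ∨ localGate M D v u = 0 ∨ localGate M D v u = 1 := by
  simp only [localGate, Matrix.of_apply]
  split_ifs
  · exact Or.inl (localMat_apply_mem_amplitudes D _ _)
  · exact Or.inr (Or.inl rfl)
  · exact Or.inr (Or.inr rfl)
  · exact Or.inr (Or.inl rfl)

/-- Summing a function of the decoded label over the codes is summing over the pairs. [folklore] -/
theorem sum_ite_isCode {β : Type*} [AddCommMonoid β] (f : M.Λ × M.Γ → β) :
    ∑ v : QReg (kq M + ks M), (if IsCode M v then f (dec M v) else 0) = ∑ y : M.Λ × M.Γ, f y := by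
  classical
  rw [← Finset.sum_filter]
  have himg : (Finset.univ.filter fun v : QReg (kq M + ks M) => IsCode M v) =
      Finset.univ.image (codeSR M) := by
    ext v
    simp only [Finset.mem_filter, Finset.mem_univ, true_and, Finset.mem_image]
    exact ⟨fun h => ⟨dec M v, h⟩, fun ⟨x, hx⟩ => hx ▸ isCode_codeSR x⟩
  rw [himg, Finset.sum_image fun x _ y _ h => codeSR_injective h]
  simp

/-- **The local gate is unitary when the local matrix is** (block structure: `A_D` on the span
of the codes, the identity on its complement). [cite: NishimuraOzawa2002, Thm. 4.3 (proof)] -/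
theorem localGate_mem_unitaryGroup {D : M.Λ → Dir}
    (hA : M.localMat D ∈ Matrix.unitaryGroup (M.Λ × M.Γ) ℂ) :
    localGate M D ∈ Matrix.unitaryGroup (QReg (kq M + ks M)) ℂ := by
  classical
  have hAA : ∀ x x' : M.Λ × M.Γ, ∑ y, star (M.localMat D y x) * M.localMat D y x' =
      if x = x' then 1 else 0 := by
    intro x x'
    have h := Matrix.mem_unitaryGroup_iff'.1 hA
    have := congrFun (congrFun h x) x'
    rw [Matrix.mul_apply, Matrix.one_apply] at this
    simpa [Matrix.star_eq_conjTranspose, Matrix.conjTranspose_apply] using this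
  rw [Matrix.mem_unitaryGroup_iff']
  ext u u'
  rw [Matrix.mul_apply, Matrix.one_apply]
  simp only [Matrix.star_eq_conjTranspose, Matrix.conjTranspose_apply]
  by_cases hu : IsCode M u
  · obtain ⟨x, rfl⟩ := isCode_iff.1 hu
    by_cases hu' : IsCode M u'
    · obtain ⟨x', rfl⟩ := isCode_iff.1 hu'
      -- code / code: `(A† A)[x, x']`
      have hterm : ∀ v : QReg (kq M + ks M),
          star (localGate M D v (codeSR M x)) * localGate M D v (codeSR M x') =
            if IsCode M v then star (M.localMat D (dec M v) x) * M.localMat D (dec M v) x' else 0 := by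
        intro v
        by_cases hv : IsCode M v
        · obtain ⟨y, rfl⟩ := isCode_iff.1 hv
          simp [localGate, isCode_codeSR]
        · simp [localGate, hv, isCode_codeSR]
      simp_rw [hterm]
      rw [sum_ite_isCode (fun y => star (M.localMat D y x) * M.localMat D y x'), hAA]
      by_cases hxx : x = x'
      · subst hxx; simp
      · rw [if_neg hxx, if_neg fun h => hxx (codeSR_injective h)]
    · -- code / non-code
      rw [if_neg fun h : codeSR M x = u' => hu' (h ▸ isCode_codeSR x), Finset.sum_eq_zero]
      intro v _
      rw [localGate_apply_of_not_isCode D v hu']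
      by_cases hv : v = u'
      · subst hv
        simp [localGate, hu', isCode_codeSR]
      · simp [hv]
  · by_cases hu' : IsCode M u'
    · -- non-code / code
      have hne : u ≠ u' := fun h => hu (h ▸ hu')
      rw [if_neg hne, Finset.sum_eq_zero]
      intro v _
      rw [localGate_apply_of_not_isCode D v hu]
      by_cases hv : v = u
      · subst hv
        obtain ⟨x', rfl⟩ := isCode_iff.1 hu'
        simp [localGate, hu, isCode_codeSR]
      · simp [hv]
    · -- non-code / non-code
      simp_rw [localGate_apply_of_not_isCode D _ hu, localGate_apply_of_not_isCode D _ hu']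
      rw [Finset.sum_eq_single u]
      · by_cases h : u = u' <;> simp [h]
      · intro v _ hv; simp [hv]
      · exact fun h => absurd (Finset.mem_univ u) h

/-! ### The gate set -/

/-- The gate symbols: the four Clifford+`T` symbols and the local gate. [folklore] -/
inductive YOp
  /-- a Clifford+`T` gate -/
  | ct (g : CliffordTOp)
  /-- the local gate `G₁` -/
  | loc
  deriving DecidableEq, Fintype

/-- `YOp` is encodable via `Fin 5`, with the Clifford+`T` symbols keeping their codes `0, …, 3`
and the local gate coded `4`. [folklore] -/
instance : Encodable YOp := Encodable.ofEquiv (Fin 5)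
  { toFun := fun g => match g with
      | .ct .H => 0 | .ct .S => 1 | .ct .T => 2 | .ct .CNOT => 3 | .loc => 4
    invFun := fun i => match i with
      | 0 => .ct .H | 1 => .ct .S | 2 => .ct .T | 3 => .ct .CNOT | 4 => .loc
    left_inv := fun g => by rcases g with (_ | _ | _ | _) | _ <;> rfl
    right_inv := fun i => by fin_cases i <;> rfl }

/-- Codes of the gate symbols: the Clifford+`T` symbols keep their codes. [folklore] -/
theorem encode_ct (g : CliffordTOp) : Encodable.encode (YOp.ct g) = Encodable.encode g := by
  cases g <;> rfl

/-- Code of the local gate. [folklore] -/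
theorem encode_loc : Encodable.encode YOp.loc = 4 := rfl

variable (M) in
/-- **The gate set of the simulation**: Clifford+`T` together with the local gate of `M` on
`|Q| + |Σ|` qubits (Nishimura–Ozawa 2002, Thm. 4.3: circuits over `{G₁, G₂}`; here `G₂` and the
other classical parts are Clifford+`T` words). [cite: NishimuraOzawa2002, Thm. 4.3] -/
def yaoGateSet (D : M.Λ → Dir) : QGateSet where
  Op := YOp
  arity
    | .ct g => cliffordT.arity g
    | .loc => kq M + ks M
  mat
    | .ct g => cliffordT.mat g
    | .loc => localGate M D

/-- `Encodable` instance for the gate alphabet (instance search does not unfold `yaoGateSet`). -/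
instance (D : M.Λ → Dir) : Encodable (yaoGateSet M D).Op := inferInstanceAs (Encodable YOp)

/-- `Finite` instance for the gate alphabet. -/
instance (D : M.Λ → Dir) : Finite (yaoGateSet M D).Op := inferInstanceAs (Finite YOp)

/-- `DecidableEq` instance for the gate alphabet. -/
instance (D : M.Λ → Dir) : DecidableEq (yaoGateSet M D).Op := inferInstanceAs (DecidableEq YOp)

/-- **The gate set is unitary** when the local matrix is (well-formed unidirectional machines,
`QTM.localMat_mem_unitaryGroup`). [cite: NishimuraOzawa2002, Thm. 4.3] -/
theorem yaoGateSet_isUnitary {D : M.Λ → Dir} (hA : M.localMat D ∈ Matrix.unitaryGroup (M.Λ × M.Γ) ℂ) :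
    (yaoGateSet M D).IsUnitary := by
  rintro (g | _)
  · exact cliffordT_isUnitary_holds g
  · exact localGate_mem_unitaryGroup hA

/-- The gate set of a unidirectional machine well formed in Bernstein–Vazirani's sense is
unitary. [cite: BernsteinVaziraniSICOMP1997, Thm. 5.3] -/
theorem yaoGateSet_isUnitary_of_pIsWellFormed {D : M.Λ → Dir} (hD : M.IsUnidirectionalWith D)
    (hwf : M.PIsWellFormed) : (yaoGateSet M D).IsUnitary :=
  yaoGateSet_isUnitary (localMat_mem_unitaryGroup_of_pIsWellFormed hD hwf)

/-- **Polynomial-time computable entries.** If the amplitudes of `M` are polynomial-time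
computable complex numbers (Bernstein–Vazirani 1997, Def. 3.2), so are all entries of all gates
of `yaoGateSet M D` (the Clifford+`T` entries by `cliffordT_polyTimeEntries`). [cite: BernsteinVaziraniSICOMP1997, Def. 3.2] -/
theorem yaoGateSet_polyTimeEntries {D : M.Λ → Dir} (hamp : M.amplitudes ⊆ polyTimeComputableComplex) :
    ∀ (g : (yaoGateSet M D).Op) (i j : QReg ((yaoGateSet M D).arity g)),
      (yaoGateSet M D).mat g i j ∈ polyTimeComputableComplex := by
  rintro (g | _) i j
  · exact cliffordT_polyTimeEntries g i j
  · show localGate M D i j ∈ polyTimeComputableComplex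
    rcases localGate_apply_mem D i j with h | h | h
    · exact hamp h
    · rw [h, mem_polyTimeComputableComplex_iff]
      exact ⟨by simpa using isPolyTimeComputableReal_zero, by simpa using isPolyTimeComputableReal_zero⟩
    · rw [h, mem_polyTimeComputableComplex_iff]
      exact ⟨by simpa using isPolyTimeComputableReal_one, by simpa using isPolyTimeComputableReal_zero⟩

/-! ### Clifford+`T` gates inside the gate set -/

variable {N : ℕ}

/-- A Clifford+`T` gate (or an oracle gate) as a gate over `yaoGateSet M D` on the same wires. [folklore] -/
def _root_.Literature.Computability.Cryptography.QGate.ofCT (D : M.Λ → Dir) :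
    QGate cliffordT N → QGate (yaoGateSet M D) N
  | .gate g e => .gate (YOp.ct g) e
  | .oracle k e => .oracle k e

/-- Transported gates have the same matrix. [folklore] -/
@[simp] theorem toMatrix_ofCT (D : M.Λ → Dir) (A : Language Bool) (γ : QGate cliffordT N) :
    (γ.ofCT D : QGate (yaoGateSet M D) N).toMatrix A = γ.toMatrix A := by
  cases γ <;> rfl

/-- Transported gates keep oracle-freeness. [folklore] -/
theorem isOracleFree_ofCT (D : M.Λ → Dir) {γ : QGate cliffordT N} (h : γ.IsOracleFree) :
    (γ.ofCT D : QGate (yaoGateSet M D) N).IsOracleFree := by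
  cases γ
  · trivial
  · exact h

/-- A transported circuit has the same matrix. [folklore] -/
theorem toMatrix_mapOfCT (D : M.Λ → Dir) (A : Language Bool) (gs : List (QGate cliffordT N)) :
    (⟨gs.map (QGate.ofCT D)⟩ : QCircuit (yaoGateSet M D) N).toMatrix A =
      (⟨gs⟩ : QCircuit cliffordT N).toMatrix A := by
  induction gs with
  | nil => simp
  | cons γ gs ih =>
    rw [List.map_cons, QCircuit.toMatrix_cons, QCircuit.toMatrix_cons, ih, toMatrix_ofCT]

/-- **A compiled reversible program inside the gate set acts on basis states by its classical
semantics**: `|w⟩ ↦ |revEval ops w⟩`. [cite: NielsenChuang2010, §3.2.5] -/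
theorem toMatrix_mapOfCT_revCompile_mulVec_basisState (D : M.Λ → Dir) (A : Language Bool)
    (ops : List (RevOp N)) (w : QReg N) :
    (⟨(revCompile ops).map (QGate.ofCT D)⟩ : QCircuit (yaoGateSet M D) N).toMatrix A *ᵥ basisState w =
      basisState (revEval ops w) := by
  rw [toMatrix_mapOfCT, revCompile_mulVec_basisState]

/-! ### A placed gate on a basis state -/

/-- **A placed gate on a basis state** is the superposition, over the contents `z` of its block,
of the labels obtained by overwriting the block with `z`, with amplitudes the column of the gate
at the old block contents: `U_E |w⟩ = ∑_z U[z, w|_E] |w with E ↦ z⟩`. [cite: NielsenChuang2010, §4.3] -/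
theorem placeGate_mulVec_basisState_eq_sum {k : ℕ} (E : Fin k ↪ Fin N) (U : Matrix (QReg k) (QReg k) ℂ)
    (w : QReg N) :
    placeGate E U *ᵥ basisState w = ∑ z : QReg k, U z (w ∘ E) • basisState (Function.extend E z w) := by
  funext y
  rw [placeGate_mulVec_basisState_apply, Finset.sum_apply]
  simp only [Pi.smul_apply, basisState_apply, smul_eq_mul, mul_ite, mul_one, mul_zero]
  by_cases hy : ∀ i, i ∉ Set.range E → y i = w i
  · rw [if_pos hy, Finset.sum_eq_single (y ∘ E)]
    · rw [if_pos]
      funext i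
      by_cases hi : i ∈ Set.range E
      · obtain ⟨j, rfl⟩ := hi
        exact (E.injective.extend_apply (y ∘ E) w j).symm
      · rw [Function.extend_apply' _ _ _ (fun ⟨j, hj⟩ => hi ⟨j, hj⟩), hy i hi]
    · intro z _ hz
      rw [if_neg]
      intro h
      apply hz
      funext j
      have := congrFun h (E j)
      rw [E.injective.extend_apply] at this
      exact this.symm
    · exact fun h => absurd (Finset.mem_univ _) h
  · rw [if_neg hy, Finset.sum_eq_zero]
    intro z _
    rw [if_neg]
    intro h
    apply hy
    intro i hi
    rw [h, Function.extend_apply' _ _ _ (fun ⟨j, hj⟩ => hi ⟨j, hj⟩)]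

end YaoSim

end Literature.Computability.QuantumComplexity

end
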